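import Summits.CriticalPhenomena.PercolationContinuityZ3.Theorems.PercNearOneGluingNoHeavyLowerTailCILEdgeRaisingIdentity
import Literature.Probability.Percolation.LonelyClusterExchange
import HarnessLib

/-!
# `NoHeavyLowerTail` (stmt-CriticalPhenomena-4575), line induct — the two-star one-Steiner-gate cell at EVERY level:
# reduction to single-observer validity of the displaced champion

Support file (prover `prim-gen-induct`, gen 5; `--supports stmt-CriticalPhenomena-4575`).  No definitions, no named
facts, no sorries.  Notation: `μ_w = prodBernoulli w` on `Fin n`, relays `A`, level `j`, and for an observer set `T`
and a witness `c` the two set-champion-stability events of `…CILInductionStep`: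
`L_w(T) = μ_w(c ↮ T, 1 ≤ |π(T)| ≤ j)`, `R_w(T) = μ_w(c ↮ T, |π(c)| ≤ j)`, `Δ_w(T) = R_w(T) − L_w(T)` (so `CS_w(T,c) ⇔ Δ_w(T) ≥ 0`).

THE CELL.  `H = K + v + v′` with `v` hanging on a non-relay `u` (weight `γ`) and a fresh non-relay `v′` joined to the
relay gates `a, b` (weights `α, β`); `S = {v, v′}`; `c = champ_j(H)`.  Its STEP `CS_H(S, c)` splits as
`(1−γ)·[cil at v′, relay-neighboured — a theorem] + γ·Target(α, β)` with

  `Target(α,β) = (1−α)(1−β)·Δ_K({u}) + α(1−β)·Δ_K({u,a}) + β(1−α)·Δ_K({u,b}) + αβ·Δ_K({u,a,b})`,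

and championship of `c` in `H` is championship of `c` in `G_θ := K` with the pair `ab` raised to
`w(ab) + θ(1 − w(ab))`, `θ = αβ` (`I_{G_θ} = (1−θ)I_K + θ I_{K^{ab}}`).

* `DisplacedChampion.twoStarCell_of_validAt` — **for every level `j`**: if `c` is a champion of `G_θ` and `c` is a
  valid single-observer witness at `u` in `K` (`Δ_K({u}) ≥ 0`), then `Target(α,β) ≥ 0`.  Proof = the exact identity
  `Target = (1−α)(1−β)·Δ_K({u}) + [α(1−β)·Δ_{G_θ}({u,a}) + β(1−α)·Δ_{G_θ}({u,b}) + αβ(1−α)(1−β)·Δ_K({u,a,b})]/(1−αβ)`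
  (edge raising at the pair `ab`, `CutObserver.real_setL_raise_edge` / `real_setR_raise_edge`) and the lonelier-member
  lemma in `G_θ` (`observerSet_le_of_lonelier`: the sets `{u,a}`, `{u,b}`, `{u,a,b}` contain a relay no lighter than
  the champion `c` of `G_θ`), which makes the three bracket terms non-negative.
  CONSEQUENCE (crux notes BLOBQUOTIENT.md §23 (vi)): at every level the whole difficulty of this three-gate cell is the
  single-observer validity at `u` in `K` of the DISPLACED champion `c = champ(G_θ)`; when there is no champion switch
  (`c = champ(K)`) that is the induction hypothesis and the cell is closed.  At level one the displaced validity is not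
  needed at all (`…CILDisplacedChampion.lean`, DC1).
-/

namespace Summit.CriticalPhenomena.PercolationContinuityZ3.Theorems

open scoped BigOperators Classical
open MeasureTheory Set
open Literature.Probability.LatticeModels (prodBernoulli)
open Literature.Probability.Percolation (openConn BondConfig observerSet_le_of_lonelier)

namespace DisplacedChampion

variable {n : ℕ}

open CutObserver in
/-- **The two-star one-Steiner-gate cell at every level, given validity of the displaced champion at `u`.**
`w` is the graph `K`, `wab` the raised weight of the pair `ab` (`wab = w(ab) + αβ(1 − w(ab))`, so that
`Function.update w s(a,b) wab` is `G_θ`), `c` a champion of `G_θ` at level `j`, `a, b ∈ A`, `a ≠ b`, `α, β ∈ [0,1]`.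
If `Δ_w({u}) ≥ 0` then `(1−α)(1−β)Δ_w({u}) + α(1−β)Δ_w({u,a}) + β(1−α)Δ_w({u,b}) + αβΔ_w({u,a,b}) ≥ 0`. -/
theorem twoStarCell_of_validAt (w : Sym2 (Fin n) → unitInterval) (A : Finset (Fin n)) (a b c u : Fin n) (j : ℕ)
    (ha : a ∈ A) (hb : b ∈ A) (hab : a ≠ b) (α β : ℝ) (hα0 : 0 ≤ α) (hα1 : α ≤ 1) (hβ0 : 0 ≤ β) (hβ1 : β ≤ 1)
    (wab : unitInterval) (hwab : (wab : ℝ) = (w s(a, b) : ℝ) + α * β * (1 - (w s(a, b) : ℝ)))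
    (hchamp : ∀ x ∈ A,
      (prodBernoulli (Function.update w s(a, b) wab)).real
          {ω : BondConfig (Fin n) | (A.filter fun z => ω ∈ openConn x z).card ≤ j} ≤
        (prodBernoulli (Function.update w s(a, b) wab)).real
          {ω : BondConfig (Fin n) | (A.filter fun z => ω ∈ openConn c z).card ≤ j})
    (hval : (prodBernoulli w).real {ω : BondConfig (Fin n) |
        (∀ x ∈ ({u} : Finset (Fin n)), ω ∉ openConn c x) ∧
        1 ≤ (A.filter fun z => ∃ x ∈ ({u} : Finset (Fin n)), ω ∈ openConn x z).card ∧
        (A.filter fun z => ∃ x ∈ ({u} : Finset (Fin n)), ω ∈ openConn x z).card ≤ j} ≤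
      (prodBernoulli w).real {ω : BondConfig (Fin n) |
        (∀ x ∈ ({u} : Finset (Fin n)), ω ∉ openConn c x) ∧ (A.filter fun z => ω ∈ openConn c z).card ≤ j}) :
    0 ≤ (1 - α) * (1 - β) *
        ((prodBernoulli w).real {ω : BondConfig (Fin n) |
            (∀ x ∈ ({u} : Finset (Fin n)), ω ∉ openConn c x) ∧ (A.filter fun z => ω ∈ openConn c z).card ≤ j} -
          (prodBernoulli w).real {ω : BondConfig (Fin n) |
            (∀ x ∈ ({u} : Finset (Fin n)), ω ∉ openConn c x) ∧
            1 ≤ (A.filter fun z => ∃ x ∈ ({u} : Finset (Fin n)), ω ∈ openConn x z).card ∧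
            (A.filter fun z => ∃ x ∈ ({u} : Finset (Fin n)), ω ∈ openConn x z).card ≤ j}) +
      α * (1 - β) *
        ((prodBernoulli w).real {ω : BondConfig (Fin n) |
            (∀ x ∈ ({u, a} : Finset (Fin n)), ω ∉ openConn c x) ∧ (A.filter fun z => ω ∈ openConn c z).card ≤ j} -
          (prodBernoulli w).real {ω : BondConfig (Fin n) |
            (∀ x ∈ ({u, a} : Finset (Fin n)), ω ∉ openConn c x) ∧
            1 ≤ (A.filter fun z => ∃ x ∈ ({u, a} : Finset (Fin n)), ω ∈ openConn x z).card ∧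
            (A.filter fun z => ∃ x ∈ ({u, a} : Finset (Fin n)), ω ∈ openConn x z).card ≤ j}) +
      β * (1 - α) *
        ((prodBernoulli w).real {ω : BondConfig (Fin n) |
            (∀ x ∈ ({u, b} : Finset (Fin n)), ω ∉ openConn c x) ∧ (A.filter fun z => ω ∈ openConn c z).card ≤ j} -
          (prodBernoulli w).real {ω : BondConfig (Fin n) |
            (∀ x ∈ ({u, b} : Finset (Fin n)), ω ∉ openConn c x) ∧
            1 ≤ (A.filter fun z => ∃ x ∈ ({u, b} : Finset (Fin n)), ω ∈ openConn x z).card ∧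
            (A.filter fun z => ∃ x ∈ ({u, b} : Finset (Fin n)), ω ∈ openConn x z).card ≤ j}) +
      α * β *
        ((prodBernoulli w).real {ω : BondConfig (Fin n) |
            (∀ x ∈ ({u, a, b} : Finset (Fin n)), ω ∉ openConn c x) ∧ (A.filter fun z => ω ∈ openConn c z).card ≤ j} -
          (prodBernoulli w).real {ω : BondConfig (Fin n) |
            (∀ x ∈ ({u, a, b} : Finset (Fin n)), ω ∉ openConn c x) ∧
            1 ≤ (A.filter fun z => ∃ x ∈ ({u, a, b} : Finset (Fin n)), ω ∈ openConn x z).card ∧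
            (A.filter fun z => ∃ x ∈ ({u, a, b} : Finset (Fin n)), ω ∈ openConn x z).card ≤ j}) := by
  -- notation: the two events for an observer set `T`
  set evL : Finset (Fin n) → Set (BondConfig (Fin n)) := fun T => {ω : BondConfig (Fin n) |
      (∀ x ∈ T, ω ∉ openConn c x) ∧ 1 ≤ (A.filter fun z => ∃ x ∈ T, ω ∈ openConn x z).card ∧
      (A.filter fun z => ∃ x ∈ T, ω ∈ openConn x z).card ≤ j} with hevL
  set evR : Finset (Fin n) → Set (BondConfig (Fin n)) := fun T => {ω : BondConfig (Fin n) |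
      (∀ x ∈ T, ω ∉ openConn c x) ∧ (A.filter fun z => ω ∈ openConn c z).card ≤ j} with hevR
  set G := Function.update w s(a, b) wab with hG
  set w0 := Function.update w s(a, b) 0 with hw0
  set p : ℝ := (w s(a, b) : ℝ) with hp
  set Tua : Finset (Fin n) := {u, a} with hTua
  set Tub : Finset (Fin n) := {u, b} with hTub
  set T3 : Finset (Fin n) := {u, a, b} with hT3
  change 0 ≤ (1 - α) * (1 - β) * ((prodBernoulli w).real (evR {u}) - (prodBernoulli w).real (evL {u})) +
      α * (1 - β) * ((prodBernoulli w).real (evR Tua) - (prodBernoulli w).real (evL Tua)) +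
      β * (1 - α) * ((prodBernoulli w).real (evR Tub) - (prodBernoulli w).real (evL Tub)) +
      α * β * ((prodBernoulli w).real (evR T3) - (prodBernoulli w).real (evL T3))
  change (prodBernoulli w).real (evL {u}) ≤ (prodBernoulli w).real (evR {u}) at hval
  -- basic facts about the pair weights
  have hp0 : 0 ≤ p := (w s(a, b)).2.1
  have hp1 : p ≤ 1 := (w s(a, b)).2.2
  have hGab : (G s(a, b) : ℝ) = p + α * β * (1 - p) := by
    simp only [hG, Function.update_self]; exact hwab
  have hG0 : Function.update G s(a, b) 0 = w0 := by simp only [hG, hw0, Function.update_idem]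
  have hba : s(b, a) = s(a, b) := Sym2.eq_swap
  -- membership facts
  have haTua : a ∈ Tua := by simp [hTua]
  have hbTub : b ∈ Tub := by simp [hTub]
  have haT3 : a ∈ T3 := by simp [hT3]
  have hbT3 : b ∈ T3 := by simp [hT3]
  have hinsb : insert b Tua = T3 := by
    ext x; simp only [hTua, hT3, Finset.mem_insert, Finset.mem_singleton]; tauto
  have hinsa : insert a Tub = T3 := by
    ext x; simp only [hTub, hT3, Finset.mem_insert, Finset.mem_singleton]; tauto
  have hins3 : insert b T3 = T3 := Finset.insert_eq_of_mem hbT3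
  -- (1) edge raising at the pair `ab`: every quantity in terms of `w0`
  -- in `w`
  have eLua : (prodBernoulli w).real (evL Tua) =
      (1 - p) * (prodBernoulli w0).real (evL Tua) + p * (prodBernoulli w0).real (evL T3) := by
    have h := real_setL_raise_edge w A Tua a b c j haTua hab
    rw [hinsb] at h; exact h
  have eRua : (prodBernoulli w).real (evR Tua) =
      (1 - p) * (prodBernoulli w0).real (evR Tua) + p * (prodBernoulli w0).real (evR T3) := by
    have h := real_setR_raise_edge w A Tua a b c j haTua hab
    rw [hinsb] at h; exact h
  have eLub : (prodBernoulli w).real (evL Tub) =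
      (1 - p) * (prodBernoulli w0).real (evL Tub) + p * (prodBernoulli w0).real (evL T3) := by
    have h := real_setL_raise_edge w A Tub b a c j hbTub hab.symm
    rw [hinsa, hba] at h; exact h
  have eRub : (prodBernoulli w).real (evR Tub) =
      (1 - p) * (prodBernoulli w0).real (evR Tub) + p * (prodBernoulli w0).real (evR T3) := by
    have h := real_setR_raise_edge w A Tub b a c j hbTub hab.symm
    rw [hinsa, hba] at h; exact h
  have eL3 : (prodBernoulli w).real (evL T3) = (prodBernoulli w0).real (evL T3) := by
    have h := real_setL_raise_edge w A T3 a b c j haT3 hab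
    rw [hins3] at h; rw [h]; ring
  have eR3 : (prodBernoulli w).real (evR T3) = (prodBernoulli w0).real (evR T3) := by
    have h := real_setR_raise_edge w A T3 a b c j haT3 hab
    rw [hins3] at h; rw [h]; ring
  -- in `G`
  have gLua : (prodBernoulli G).real (evL Tua) =
      (1 - (p + α * β * (1 - p))) * (prodBernoulli w0).real (evL Tua) +
        (p + α * β * (1 - p)) * (prodBernoulli w0).real (evL T3) := by
    have h := real_setL_raise_edge G A Tua a b c j haTua hab
    rw [hinsb, hG0, hGab] at h; exact h
  have gRua : (prodBernoulli G).real (evR Tua) =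
      (1 - (p + α * β * (1 - p))) * (prodBernoulli w0).real (evR Tua) +
        (p + α * β * (1 - p)) * (prodBernoulli w0).real (evR T3) := by
    have h := real_setR_raise_edge G A Tua a b c j haTua hab
    rw [hinsb, hG0, hGab] at h; exact h
  have hGba : (G s(b, a) : ℝ) = p + α * β * (1 - p) := by rw [hba]; exact hGab
  have hG0' : Function.update G s(b, a) 0 = w0 := by rw [hba]; exact hG0
  have gLub : (prodBernoulli G).real (evL Tub) =
      (1 - (p + α * β * (1 - p))) * (prodBernoulli w0).real (evL Tub) +
        (p + α * β * (1 - p)) * (prodBernoulli w0).real (evL T3) := by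
    have h := real_setL_raise_edge G A Tub b a c j hbTub hab.symm
    rw [hinsa, hG0', hGba] at h; exact h
  have gRub : (prodBernoulli G).real (evR Tub) =
      (1 - (p + α * β * (1 - p))) * (prodBernoulli w0).real (evR Tub) +
        (p + α * β * (1 - p)) * (prodBernoulli w0).real (evR T3) := by
    have h := real_setR_raise_edge G A Tub b a c j hbTub hab.symm
    rw [hinsa, hG0', hGba] at h; exact h
  have gL3 : (prodBernoulli G).real (evL T3) = (prodBernoulli w0).real (evL T3) := by
    have h := real_setL_raise_edge G A T3 a b c j haT3 hab
    rw [hins3, hG0] at h; rw [h]; ring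
  have gR3 : (prodBernoulli G).real (evR T3) = (prodBernoulli w0).real (evR T3) := by
    have h := real_setR_raise_edge G A T3 a b c j haT3 hab
    rw [hins3, hG0] at h; rw [h]; ring
  -- (2) lonelier member in `G`: the sets `{u,a}`, `{u,b}`, `{u,a,b}` contain a relay no lighter than the champion `c`
  have xa : (prodBernoulli G).real (evL Tua) ≤ (prodBernoulli G).real (evR Tua) := by
    convert observerSet_le_of_lonelier G A Tua a c haTua j (hchamp a ha) using 12
  have xb : (prodBernoulli G).real (evL Tub) ≤ (prodBernoulli G).real (evR Tub) := by
    convert observerSet_le_of_lonelier G A Tub b c hbTub j (hchamp b hb) using 12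
  have xab : (prodBernoulli G).real (evL T3) ≤ (prodBernoulli G).real (evR T3) := by
    convert observerSet_le_of_lonelier G A T3 a c haT3 j (hchamp a ha) using 12
  -- (3) everything in terms of eight real numbers
  rw [eLua, eRua, eLub, eRub, eL3, eR3]
  rw [gLua, gRua] at xa
  rw [gLub, gRub] at xb
  rw [gL3, gR3] at xab
  set lua := (prodBernoulli w0).real (evL Tua) with hlua
  set rua := (prodBernoulli w0).real (evR Tua) with hrua
  set lub := (prodBernoulli w0).real (evL Tub) with hlub
  set rub := (prodBernoulli w0).real (evR Tub) with hrub
  set l3 := (prodBernoulli w0).real (evL T3) with hl3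
  set r3 := (prodBernoulli w0).real (evR T3) with hr3
  set lu := (prodBernoulli w).real (evL {u}) with hlu
  set ru := (prodBernoulli w).real (evR {u}) with hru
  set θ' : ℝ := p + α * β * (1 - p) with hθ'
  -- signs
  have hDu0 : 0 ≤ ru - lu := by linarith
  have hxa' : 0 ≤ (1 - θ') * (rua - lua) + θ' * (r3 - l3) := by linarith
  have hxb' : 0 ≤ (1 - θ') * (rub - lub) + θ' * (r3 - l3) := by linarith
  have hx3' : 0 ≤ r3 - l3 := by linarith
  have h1a : 0 ≤ 1 - α := by linarith
  have h1b : 0 ≤ 1 - β := by linarith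
  have hab0 : 0 ≤ α * β := mul_nonneg hα0 hβ0
  have hαβ1 : α * β ≤ 1 := by
    have := mul_le_mul hα1 hβ1 hβ0 zero_le_one
    linarith
  have hκ0 : 0 ≤ 1 - α * β := by linarith
  clear eLua eRua eLub eRub eL3 eR3 gLua gRua gLub gRub gL3 gR3 hGab hGba hG0 hG0' hinsb hinsa hins3
  -- the identity: (1 - αβ) · Target = (1-αβ)(1-α)(1-β)(ru-lu) + α(1-β)·x_a + β(1-α)·x_b + αβ(1-α)(1-β)·(r3-l3)
  have hid : (1 - α * β) * ((1 - α) * (1 - β) * (ru - lu) +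
        α * (1 - β) * ((1 - p) * rua + p * r3 - ((1 - p) * lua + p * l3)) +
        β * (1 - α) * ((1 - p) * rub + p * r3 - ((1 - p) * lub + p * l3)) +
        α * β * (r3 - l3)) =
      (1 - α * β) * ((1 - α) * (1 - β)) * (ru - lu) +
        α * (1 - β) * ((1 - θ') * (rua - lua) + θ' * (r3 - l3)) +
        β * (1 - α) * ((1 - θ') * (rub - lub) + θ' * (r3 - l3)) +
        α * β * ((1 - α) * (1 - β)) * (r3 - l3) := by
    rw [hθ']; ring
  have hrhs : 0 ≤ (1 - α * β) * ((1 - α) * (1 - β) * (ru - lu) +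
        α * (1 - β) * ((1 - p) * rua + p * r3 - ((1 - p) * lua + p * l3)) +
        β * (1 - α) * ((1 - p) * rub + p * r3 - ((1 - p) * lub + p * l3)) +
        α * β * (r3 - l3)) := by
    rw [hid]
    have t1 : 0 ≤ (1 - α * β) * ((1 - α) * (1 - β)) * (ru - lu) :=
      mul_nonneg (mul_nonneg hκ0 (mul_nonneg h1a h1b)) hDu0
    have t2 : 0 ≤ α * (1 - β) * ((1 - θ') * (rua - lua) + θ' * (r3 - l3)) :=
      mul_nonneg (mul_nonneg hα0 h1b) hxa'
    have t3 : 0 ≤ β * (1 - α) * ((1 - θ') * (rub - lub) + θ' * (r3 - l3)) :=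
      mul_nonneg (mul_nonneg hβ0 h1a) hxb'
    have t4 : 0 ≤ α * β * ((1 - α) * (1 - β)) * (r3 - l3) :=
      mul_nonneg (mul_nonneg hab0 (mul_nonneg h1a h1b)) hx3'
    linarith
  by_cases hκ : 1 - α * β = 0
  · -- α = β = 1: the target is r3 - l3 ≥ 0
    have hα : α = 1 := le_antisymm hα1 (by have := mul_le_of_le_one_right hα0 hβ1; linarith)
    have hβ : β = 1 := le_antisymm hβ1 (by have := mul_le_of_le_one_left hβ0 hα1; linarith)
    have : (1 - α) * (1 - β) * (ru - lu) + α * (1 - β) * ((1 - p) * rua + p * r3 - ((1 - p) * lua + p * l3)) +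
        β * (1 - α) * ((1 - p) * rub + p * r3 - ((1 - p) * lub + p * l3)) + α * β * (r3 - l3) = r3 - l3 := by
      rw [hα, hβ]; ring
    rw [this]; exact hx3'
  · have hκpos : 0 < 1 - α * β := lt_of_le_of_ne hκ0 (Ne.symm hκ)
    refine le_of_mul_le_mul_left ?_ hκpos
    rw [mul_zero]; exact hrhs

end DisplacedChampion

end Summit.CriticalPhenomena.PercolationContinuityZ3.Theorems
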